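import Mathlib
import Summits.ResolutionOfSingularities.ResolutionOfSingularities.Theorems.HomologicalConductorPersistenceCyclicTransferSyzygy
import Literature.RingTheory.IntegralClosure.KrullIntersection
import HarnessLib

/-!
# Crux `Persistence` (stmt-16484) / rung S-2 `PersistenceSurface` (stmt-19970) — cyclic transfer, part 6:
# the REYNOLDS PAIRING IS PERFECT over a normal domain when every isotypic component has height ≥ 2;
# the Veronese lemma T-V with standard hypotheses (chain W4.4b, seat res-L1-w44b-stub-4 gen 4)

[OURS · L1 w44b] Nothing here is a statement of the manuscript under review (Hironaka 2017); AI-written, weaker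
than expert review.

SETTING as in parts 1–5 (`U = V^σ`, `σ ^ d = 1`, `ω` with `ω ^ d = 1` and character orthogonality, `d ∈ Uˣ`),
with `V` a NOETHERIAN NORMAL DOMAIN, and the hypothesis
  (BIG) for every `j < d` and every height-one prime `P ⊂ V` some `m ∉ P` has character `ω^j` (`σ m = ω^j m`)
(«the action is free in codimension one»: each isotypic component `V_{[j]}` generates an ideal of height `≥ 2`;
for a two-dimensional graded `V` with the grading action of `μ_n`: `V_{[j]}·V` is primary to the vertex).

RESULTS.
* `exists_eq_mul_of_character` — for a `U`-linear `φ : V → U` and `j < d` there is `y ∈ V` of character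
  `ω^{-j}` with `φ(m) = m·y` for every `m` of character `ω^j` (fractions + Krull's `V = ⋂_{ht P = 1} V_P`,
  tree `Literature.RingTheory.IntegralClosure.exists_algebraMap_eq_of_forall_height_eq_one`).
* **`reynoldsPairing_existsUnique`** — PERFECT PAIRING: every `U`-linear `φ : V → U` is `v ↦ ρ(v w)` for a unique
  `w ∈ V` (`ρ` the Reynolds operator of part 4).
* `finite_projective_coind_of_isIntegrallyClosed` — hence the Frobenius hypothesis of part 5:
  `Hom_U(V, U)` is finitely generated projective (free of rank one) over `V`.
* **`mul_mem_cohomologyAnnihilatorOfDegree_three_of_isIntegrallyClosed`** — VERONESE LEMMA T-V at level `ca³`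
  with standard hypotheses: `V` noetherian normal domain, `U` noetherian, (BIG), `c ∈ ca³(V)` of character `ω^γ`,
  `a ∈ 𝔞_γ` ⟹ `a c ∈ ca³(U)`; pure-power form `pow_mem_cohomologyAnnihilatorOfDegree_three_of_isIntegrallyClosed`.

References: Matsumura, *Commutative Ring Theory*, Thm. 11.5 (ii) [`Matsumura1987`] (through the tree lemma);
Iyengar–Takahashi, IMRN 2016, Remark 2.13 [`IyengarTakahashi2014`]; folklore (Reynolds operator, perfect pairing for
covers unramified in codimension one).
-/

-- single-problem summit: the doubled namespace component `ResolutionOfSingularities` is forced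
set_option linter.dupNamespace false

noncomputable section

open CategoryTheory Literature.RingTheory.CohomologyAnnihilator
open Summit.ResolutionOfSingularities.ResolutionOfSingularities.Theorems.NoZeno.SandwichCluster
open Summit.ResolutionOfSingularities.ResolutionOfSingularities.Theorems.HomologicalConductor.PersistenceCyclicTransferFamily
open Summit.ResolutionOfSingularities.ResolutionOfSingularities.Theorems.HomologicalConductor.PersistenceCyclicTransferCoinduced
open Summit.ResolutionOfSingularities.ResolutionOfSingularities.Theorems.HomologicalConductor.PersistenceCyclicTransferSyzygy

universe u

namespace Summit.ResolutionOfSingularities.ResolutionOfSingularities.Theorems.HomologicalConductor.PersistenceCyclicTransferPairing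

variable {U V : Type u} [CommRing U] [CommRing V] [Algebra U V]

/-! ## Isotypic projectors -/

/-- The ISOTYPIC PROJECTOR `P_j v = ∑_{i<d} η^{(d-j) i} σⁱ v` has character `η^j` (`σ (P_j v) = η^j P_j v`), for
`η = algebraMap ω`, `ω ^ d = 1`, `σ ^ d = 1`, `j ≤ d`. [folklore] -/
theorem apply_projector_eq (σ : V →ₐ[U] V) {d : ℕ} (hσd : σ ^ d = 1) (ω : U) (hωd : ω ^ d = 1) {j : ℕ}
    (hj : j ≤ d) (v : V) :
    σ (∑ i ∈ Finset.range d, algebraMap U V ω ^ ((d - j) * i) * (σ ^ i) v) =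
      algebraMap U V ω ^ j * ∑ i ∈ Finset.range d, algebraMap U V ω ^ ((d - j) * i) * (σ ^ i) v := by
  set η : V := algebraMap U V ω with hηdef
  have hηd : η ^ d = 1 := by rw [hηdef, ← map_pow, hωd, map_one]
  have hση : σ η = η := AlgHom.commutes σ ω
  rw [map_sum, Finset.mul_sum]
  have hper : (fun i => η ^ j * (η ^ ((d - j) * i) * (σ ^ i) v)) d =
      (fun i => η ^ j * (η ^ ((d - j) * i) * (σ ^ i) v)) 0 := by
    simp only [hσd, mul_zero, pow_zero, one_mul, AlgHom.one_apply]
    rw [mul_comm (d - j) d, pow_mul, hηd, one_pow, one_mul]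
  rw [← sum_range_succ_shift d (fun i => η ^ j * (η ^ ((d - j) * i) * (σ ^ i) v)) hper]
  refine Finset.sum_congr rfl fun i _ => ?_
  simp only [map_mul, map_pow, hση, pow_succ, AlgHom.mul_apply]
  -- `η^{(d-j) i} σ^{i+1} v` vs `η^j η^{(d-j)(i+1)} σ^{i+1} v`
  rw [← mul_assoc]
  congr 1
  · rw [← pow_add, show j + (d - j) * (i + 1) = (d - j) * i + d * 1 by
      zify [hj]; ring, pow_add, mul_one, hηd, mul_one]
  · rw [← AlgHom.mul_apply, ← AlgHom.mul_apply, ← pow_succ', ← pow_succ]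

/-- The isotypic projectors sum to `d`: `∑_{j<d} P_j v = d • v`. [folklore] -/
theorem sum_projector_eq (σ : V →ₐ[U] V) {d : ℕ} (hd : 0 < d) (ω : U) (hωd : ω ^ d = 1)
    (horth : ∀ m : ℕ, ¬ d ∣ m → ∑ i ∈ Finset.range d, ω ^ (m * i) = 0) (v : V) :
    ∑ j ∈ Finset.range d, ∑ i ∈ Finset.range d, algebraMap U V ω ^ ((d - j) * i) * (σ ^ i) v = (d : V) * v := by
  set η : V := algebraMap U V ω with hηdef
  have hηd : η ^ d = 1 := by rw [hηdef, ← map_pow, hωd, map_one]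
  have horthV : ∀ m : ℕ, ¬ d ∣ m → ∑ i ∈ Finset.range d, η ^ (m * i) = 0 := fun m hm => by
    have := congrArg (algebraMap U V) (horth m hm)
    simpa [hηdef, map_sum, map_pow] using this
  rw [Finset.sum_comm]
  -- coefficient of `σ^i v`: `∑_j η^{(d-j) i} = d [i = 0]` for `i < d`
  have hcoef : ∀ i ∈ Finset.range d, ∑ j ∈ Finset.range d, η ^ ((d - j) * i) = if i = 0 then (d : V) else 0 := by
    intro i hi
    rw [Finset.mem_range] at hi
    have hrefl : ∑ j ∈ Finset.range d, η ^ ((d - j) * i) = ∑ j ∈ Finset.range d, η ^ ((j + 1) * i) := by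
      rw [← Finset.sum_range_reflect (fun j => η ^ ((j + 1) * i)) d]
      refine Finset.sum_congr rfl fun j hj => ?_
      rw [Finset.mem_range] at hj
      congr 2
      omega
    rw [hrefl]
    by_cases h0 : i = 0
    · subst h0; simp
    · rw [if_neg h0]
      have hper : (fun j => η ^ (j * i)) d = (fun j => η ^ (j * i)) 0 := by
        simp only [zero_mul, pow_zero]
        rw [pow_mul, hηd, one_pow]
      rw [sum_range_succ_shift d (fun j => η ^ (j * i)) hper]
      have : ∑ j ∈ Finset.range d, η ^ (j * i) = ∑ j ∈ Finset.range d, η ^ (i * j) :=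
        Finset.sum_congr rfl fun j _ => by rw [mul_comm]
      rw [this]
      exact horthV i fun hdvd => h0 (Nat.eq_zero_of_dvd_of_lt hdvd hi)
  rw [Finset.sum_congr rfl fun i hi => by rw [← Finset.sum_mul, hcoef i hi],
    Finset.sum_eq_single 0 (fun i _ hi => by rw [if_neg hi, zero_mul])
      (fun h => absurd (Finset.mem_range.mpr hd) h),
    if_pos rfl, pow_zero, AlgHom.one_apply]

/-- Powers of the character relation with natural exponent bookkeeping: `η^{k(d-1)i} = η^{(d-k)i}` for `k ≤ d`
(both are inverse to `η^{ki}`). [folklore] -/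
theorem pow_mul_pred_mul_eq {η : V} {d : ℕ} (hηd : η ^ d = 1) {k : ℕ} (hk : k ≤ d) (i : ℕ) :
    η ^ (k * (d - 1) * i) = η ^ ((d - k) * i) := by
  rcases Nat.eq_zero_or_pos d with rfl | hd
  · simp at hk; subst hk; simp
  have e1 : η ^ (k * (d - 1) * i) * η ^ (k * i) = 1 := by
    rw [← pow_add, show k * (d - 1) * i + k * i = d * (k * i) by zify [hd]; ring, pow_mul, hηd, one_pow]
  have e2 : η ^ ((d - k) * i) * η ^ (k * i) = 1 := by
    rw [← pow_add, show (d - k) * i + k * i = d * i by zify [hk]; ring, pow_mul, hηd, one_pow]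
  calc η ^ (k * (d - 1) * i) = η ^ (k * (d - 1) * i) * (η ^ ((d - k) * i) * η ^ (k * i)) := by rw [e2, mul_one]
    _ = η ^ ((d - k) * i) * (η ^ (k * (d - 1) * i) * η ^ (k * i)) := by ring
    _ = η ^ ((d - k) * i) := by rw [e1, mul_one]

/-! ## Linear forms on an isotypic component are multiplications (normal domain, Krull) -/

section Normal

variable [IsDomain V] [IsNoetherianRing V] [IsIntegrallyClosed V]

/-- **A `U`-linear form is a multiplication on each isotypic component.**  `V` a noetherian normal domain; if some
element of character `ω^j` avoids each height-one prime, then for every `U`-linear `φ : V → U` there is `y ∈ V` of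
character `ω^{d-j}` with `φ(m) = m·y` for all `m` of character `ω^j`.  Proof: `m₀ φ(m) = m φ(m₀)` (multiply by the
invariants `m₀^{d-1} m`, `m₀^d`), so `φ = (φ(m₀)/m₀)·` on `V_{[j]}`; the fraction lies in `V_P` for every height-one
`P` (use an `m ∉ P`), hence in `V` (Matsumura 11.5 (ii)). [folklore] -/
theorem exists_eq_mul_of_character (σ : V →ₐ[U] V) {d : ℕ} (hd : 0 < d)
    (hfix : ∀ v : V, σ v = v → ∃ u : U, algebraMap U V u = v)
    (ω : U) (hωd : ω ^ d = 1) {j : ℕ} (hj : j < d)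
    (hbig : ∀ P : Ideal V, P.IsPrime → P.height = 1 → ∃ m : V, σ m = algebraMap U V ω ^ j * m ∧ m ∉ P)
    (φ : ((ModuleCat.restrictScalars (algebraMap U V)).obj (ModuleCat.of V V)) →ₗ[U] U) :
    ∃ y : V, σ y = algebraMap U V ω ^ (d - j) * y ∧
      ∀ m : V, σ m = algebraMap U V ω ^ j * m → algebraMap U V (φ m) = m * y := by
  classical
  set η : V := algebraMap U V ω with hηdef
  have hηd : η ^ d = 1 := by rw [hηdef, ← map_pow, hωd, map_one]
  let toW : V → ((ModuleCat.restrictScalars (algebraMap U V)).obj (ModuleCat.of V V)) := fun v => v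
  have hφW : ∀ m : V, φ m = φ (toW m) := fun _ => rfl
  rcases em (∃ m₀ : V, σ m₀ = η ^ j * m₀ ∧ m₀ ≠ 0) with ⟨m₀, hm₀, hm₀ne⟩ | hzero
  swap
  · have hz : ∀ m : V, σ m = η ^ j * m → m = 0 := fun m hm => by
      by_contra hne
      exact hzero ⟨m, hm, hne⟩
    refine ⟨0, by simp, fun m hm => ?_⟩
    rw [hz m hm, hφW, show toW 0 = 0 from rfl, map_zero, map_zero, zero_mul]
  -- the power identity `(η^j)^(d-1) * η^j = 1`
  have hηj : (η ^ j) ^ (d - 1) * η ^ j = 1 := by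
    rw [← pow_succ, Nat.sub_add_cancel hd, ← pow_mul, mul_comm, pow_mul, hηd, one_pow]
  have hηj' : (η ^ j) ^ d = 1 := by rw [← pow_mul, mul_comm, pow_mul, hηd, one_pow]
  -- `m₀ φ(m) = m φ(m₀)` on the component
  have key : ∀ m : V, σ m = η ^ j * m → m₀ * algebraMap U V (φ (toW m)) = m * algebraMap U V (φ (toW m₀)) := by
    intro m hm
    have hu₁ : σ (m₀ ^ (d - 1) * m) = m₀ ^ (d - 1) * m := by
      rw [map_mul, map_pow, hm₀, hm, mul_pow]
      linear_combination (m₀ ^ (d - 1) * m) * hηj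
    obtain ⟨u₁, hu₁'⟩ := hfix _ hu₁
    have hu₀ : σ (m₀ ^ d) = m₀ ^ d := by
      rw [map_pow, hm₀, mul_pow, hηj', one_mul]
    obtain ⟨u₀, hu₀'⟩ := hfix _ hu₀
    have hsm : u₀ • toW m = u₁ • toW m₀ := by
      change toW (algebraMap U V u₀ * m) = toW (algebraMap U V u₁ * m₀)
      rw [hu₀', hu₁', mul_right_comm, ← pow_succ, Nat.sub_add_cancel hd]
    have h1 : u₀ * φ (toW m) = u₁ * φ (toW m₀) := by
      rw [← smul_eq_mul, ← smul_eq_mul, ← map_smul, ← map_smul, hsm]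
    have h2 := congrArg (algebraMap U V) h1
    rw [map_mul, map_mul, hu₀', hu₁'] at h2
    have h3 : m₀ ^ (d - 1) * (m₀ * algebraMap U V (φ (toW m)) - m * algebraMap U V (φ (toW m₀))) = 0 := by
      rw [mul_sub, ← mul_assoc, ← pow_succ, Nat.sub_add_cancel hd, h2]
      ring
    exact sub_eq_zero.mp ((mul_eq_zero.mp h3).resolve_left (pow_ne_zero _ hm₀ne))
  -- the fraction `φ(m₀)/m₀` lies in `V`
  let K := FractionRing V
  have hm₀K : algebraMap V K m₀ ≠ 0 := IsFractionRing.to_map_eq_zero_iff.not.mpr hm₀ne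
  let f : K := algebraMap V K (algebraMap U V (φ (toW m₀))) / algebraMap V K m₀
  have hfm : ∀ m : V, σ m = η ^ j * m → algebraMap V K m * f = algebraMap V K (algebraMap U V (φ (toW m))) := by
    intro m hm
    change algebraMap V K m * (algebraMap V K (algebraMap U V (φ (toW m₀))) / algebraMap V K m₀) = _
    rw [div_eq_mul_inv, ← mul_assoc, ← map_mul, ← key m hm, map_mul, mul_right_comm, mul_inv_cancel₀ hm₀K,
      one_mul]
  obtain ⟨y, hy⟩ := Literature.RingTheory.IntegralClosure.exists_algebraMap_eq_of_forall_height_eq_one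
    (R := V) (K := K) f fun P hP hP1 => by
      obtain ⟨m, hm, hmP⟩ := hbig P hP hP1
      exact ⟨m, hmP, algebraMap U V (φ (toW m)), hfm m hm⟩
  have hmul : ∀ m : V, σ m = η ^ j * m → algebraMap U V (φ (toW m)) = m * y := by
    intro m hm
    apply IsFractionRing.injective V K
    rw [map_mul, hy, hfm m hm]
  refine ⟨y, ?_, fun m hm => by rw [hφW]; exact hmul m hm⟩
  -- character of `y`: apply `σ` to `m₀ y = φ(m₀)`
  have h0 := hmul m₀ hm₀
  have h1 : σ (m₀ * y) = m₀ * y := by rw [← h0, AlgHom.commutes]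
  rw [map_mul, hm₀] at h1
  have h2 : m₀ * (η ^ j * σ y - y) = 0 := by linear_combination h1
  have h3 : η ^ j * σ y = y := sub_eq_zero.mp ((mul_eq_zero.mp h2).resolve_left hm₀ne)
  calc σ y = η ^ (d - j) * η ^ j * σ y := by rw [← pow_add, Nat.sub_add_cancel hj.le, hηd, one_mul]
    _ = η ^ (d - j) * y := by rw [mul_assoc, h3]

/-- **PERFECT REYNOLDS PAIRING.**  `V` a noetherian normal domain with (BIG); `ρ` the Reynolds operator
(`ρ ∘ algebraMap = id`, `ρ ∘ σ = ρ`, `d·ρ = ∑ σⁱ`).  Then every `U`-linear `φ : V → U` is `v ↦ ρ(v w)` for a UNIQUE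
`w ∈ V` (`w = ∑_j y_j` with `y_j` from `exists_eq_mul_of_character`; uniqueness: `ρ(q^{d-1}·δ) = q^d/d` for the
isotypic component `q = P_k δ`). [folklore] -/
theorem reynoldsPairing_existsUnique (σ : V →ₐ[U] V) {d : ℕ} (hd : 0 < d) (hσd : σ ^ d = 1)
    (hfix : ∀ v : V, σ v = v → ∃ u : U, algebraMap U V u = v) (hinj : Function.Injective (algebraMap U V))
    (ω : U) (hωd : ω ^ d = 1) (horth : ∀ m : ℕ, ¬ d ∣ m → ∑ i ∈ Finset.range d, ω ^ (m * i) = 0)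
    (hdU : IsUnit ((d : ℕ) : U))
    (hbig : ∀ j, j < d → ∀ P : Ideal V, P.IsPrime → P.height = 1 →
      ∃ m : V, σ m = algebraMap U V ω ^ j * m ∧ m ∉ P)
    (ρ : V →ₗ[U] U) (hρσ : ∀ v, ρ (σ v) = ρ v)
    (hρsum : ∀ v, (d : V) * algebraMap U V (ρ v) = ∑ i ∈ Finset.range d, (σ ^ i) v)
    (φ : ((ModuleCat.restrictScalars (algebraMap U V)).obj (ModuleCat.of V V)) →ₗ[U] U) :
    ∃! w : V, ∀ v : V, φ v = ρ (v * w) := by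
  classical
  set η : V := algebraMap U V ω with hηdef
  have hηd : η ^ d = 1 := by rw [hηdef, ← map_pow, hωd, map_one]
  let toW : V → ((ModuleCat.restrictScalars (algebraMap U V)).obj (ModuleCat.of V V)) := fun v => v
  have hφW : ∀ m : V, φ m = φ (toW m) := fun _ => rfl
  obtain ⟨du, hdu⟩ := hdU
  have hdV : IsUnit (d : V) := by
    rw [← map_natCast (algebraMap U V), ← hdu]; exact (du.isUnit).map _
  have hρpow : ∀ k v, ρ ((σ ^ k) v) = ρ v := apply_pow_eq_of_apply_eq σ ρ hρσ
  -- the projectors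
  let Pr : ℕ → V → V := fun j v => ∑ i ∈ Finset.range d, η ^ ((d - j) * i) * (σ ^ i) v
  have hPr : ∀ j, j < d → ∀ v, σ (Pr j v) = η ^ j * Pr j v := fun j hj v => apply_projector_eq σ hσd ω hωd hj.le v
  have hPrsum : ∀ v, ∑ j ∈ Finset.range d, Pr j v = (d : V) * v := fun v => sum_projector_eq σ hd ω hωd horth v
  -- the isotypic multipliers `y_j`
  choose y hychar hy using fun j : Fin d =>
    exists_eq_mul_of_character σ hd hfix ω hωd j.isLt (hbig j j.isLt) φ
  -- `σ^i y_j = η^{(d-j) i} y_j`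
  have hyσ : ∀ (j : Fin d) (i : ℕ), (σ ^ i) (y j) = η ^ ((d - j) * i) * y j := fun j i => by
    rw [pow_apply_eq_pow_mul σ (ω ^ (d - (j : ℕ))) (by rw [map_pow]; exact hychar j) i, map_pow, ← pow_mul]
  -- `∑ᵢ σⁱ(v w') = ∑_j P_j(v) y_j` for `w' = ∑ y_j`
  have hsumσ : ∀ v, ∑ i ∈ Finset.range d, (σ ^ i) (v * ∑ j : Fin d, y j) = ∑ j : Fin d, Pr j v * y j := by
    intro v
    rw [show (∑ j : Fin d, Pr j v * y j) =
        ∑ j : Fin d, ∑ i ∈ Finset.range d, η ^ ((d - j) * i) * (σ ^ i) v * y j from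
      Finset.sum_congr rfl fun j _ => Finset.sum_mul _ _ _, Finset.sum_comm]
    refine Finset.sum_congr rfl fun i _ => ?_
    rw [map_mul, map_sum, Finset.mul_sum]
    refine Finset.sum_congr rfl fun j _ => ?_
    rw [hyσ]
    ring
  -- both sides of the pairing identity, multiplied by `d` and mapped to `V`
  have hR : ∀ v, algebraMap U V ((d : U) * ρ (v * ∑ j : Fin d, y j)) = ∑ j : Fin d, Pr j v * y j := fun v => by
    rw [map_mul, map_natCast, hρsum, hsumσ]
  have hL : ∀ v : V, algebraMap U V ((d : U) * φ v) = ∑ j : Fin d, Pr j v * y j := by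
    intro v
    have e1 : (d : U) * φ v = φ ((d : U) • toW v) := by rw [map_smul, smul_eq_mul]
    have e2 : (d : U) • toW v = toW (∑ j ∈ Finset.range d, Pr j v) := by
      change toW (algebraMap U V (d : U) * v) = toW (∑ j ∈ Finset.range d, Pr j v)
      rw [map_natCast, hPrsum]
    rw [e1, e2, show toW (∑ j ∈ Finset.range d, Pr j v) = ∑ j ∈ Finset.range d, toW (Pr j v) from rfl, map_sum,
      map_sum, Finset.sum_range]
    exact Finset.sum_congr rfl fun j _ => hy j (Pr j v) (hPr j j.isLt v)
  have hpair : ∀ v : V, φ v = ρ (v * ∑ j : Fin d, y j) := fun v => by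
    apply du.isUnit.mul_left_cancel
    rw [hdu]
    exact hinj ((hL v).trans (hR v).symm)
  refine ⟨∑ j : Fin d, y j, hpair, fun w' hw' => ?_⟩
  -- uniqueness: `δ := w' - w` pairs to zero with everything, hence every isotypic component vanishes
  set δ := w' - ∑ j : Fin d, y j with hδ
  have hzero : ∀ v : V, ρ (v * δ) = 0 := fun v => by
    rw [hδ, mul_sub, map_sub, ← hw' v, ← hpair v, sub_self]
  -- each `P_k δ = 0`
  have hcomp : ∀ k, k < d → Pr k δ = 0 := by
    intro k hk
    set q := Pr k δ with hq
    have hqc : σ q = algebraMap U V (ω ^ k) * q := by rw [map_pow]; exact hPr k hk δ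
    have hqσ : ∀ i, (σ ^ i) q = algebraMap U V (ω ^ k) ^ i * q := fun i => pow_apply_eq_pow_mul σ (ω ^ k) hqc i
    have h1 : (d : V) * algebraMap U V (ρ (q ^ (d - 1) * δ)) = q ^ (d - 1) * q := by
      rw [hρsum]
      change _ = q ^ (d - 1) * ∑ i ∈ Finset.range d, η ^ ((d - k) * i) * (σ ^ i) δ
      rw [Finset.mul_sum]
      refine Finset.sum_congr rfl fun i _ => ?_
      rw [map_mul, map_pow, hqσ i, map_pow, mul_pow, ← pow_mul, ← pow_mul,
        show k * (i * (d - 1)) = k * (d - 1) * i by ring, pow_mul_pred_mul_eq hηd hk.le i]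
      ring
    rw [hzero, map_zero, mul_zero, ← pow_succ, Nat.sub_add_cancel hd] at h1
    exact (pow_eq_zero_iff (Nat.pos_iff_ne_zero.mp hd)).mp h1.symm
  have hdδ : (d : V) * δ = 0 := by
    rw [← hPrsum δ]
    exact Finset.sum_eq_zero fun k hk => hcomp k (Finset.mem_range.mp hk)
  have : δ = 0 := (hdV.mul_right_eq_zero).mp hdδ
  rw [hδ, sub_eq_zero] at this
  exact this

/-- **The Frobenius hypothesis from normality**: `V` a noetherian normal domain with (BIG) ⟹ `Hom_U(V, U)` is a
finitely generated projective `V`-module (free of rank one on the Reynolds operator). [folklore] -/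
theorem finite_projective_coind_of_isIntegrallyClosed (σ : V →ₐ[U] V) {d : ℕ} (hd : 0 < d) (hσd : σ ^ d = 1)
    (hfix : ∀ v : V, σ v = v → ∃ u : U, algebraMap U V u = v) (hinj : Function.Injective (algebraMap U V))
    (ω : U) (hωd : ω ^ d = 1) (horth : ∀ m : ℕ, ¬ d ∣ m → ∑ i ∈ Finset.range d, ω ^ (m * i) = 0)
    (hdU : IsUnit ((d : ℕ) : U))
    (hbig : ∀ j, j < d → ∀ P : Ideal V, P.IsPrime → P.height = 1 →
      ∃ m : V, σ m = algebraMap U V ω ^ j * m ∧ m ∉ P) :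
    Module.Finite V (((ModuleCat.restrictScalars (algebraMap U V)).obj (ModuleCat.of V V)) →ₗ[U] U) ∧
      Module.Projective V (((ModuleCat.restrictScalars (algebraMap U V)).obj (ModuleCat.of V V)) →ₗ[U] U) := by
  obtain ⟨ρ, -, hρσ, hρsum⟩ := exists_reynolds σ hσd hfix hinj hdU
  exact finite_projective_of_reynoldsPairing ρ
    (reynoldsPairing_existsUnique σ hd hσd hfix hinj ω hωd horth hdU hbig ρ hρσ hρsum)

/-! ## T-V with standard hypotheses -/

/-- **VERONESE LEMMA T-V at level `ca³`, standard hypotheses.**  `U` noetherian, `V` a noetherian normal domain,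
`σ ^ d = 1` with fixed ring `U`, `ω ∈ U` a `d`-th root of unity with character orthogonality, `d ∈ Uˣ`, and (BIG):
every isotypic component avoids every height-one prime.  Then `c ∈ ca³(V)` of character `ω^γ` and `a ∈ 𝔞_γ`
(decomposition data) give `a c ∈ ca³(U)`. [folklore] -/
theorem mul_mem_cohomologyAnnihilatorOfDegree_three_of_isIntegrallyClosed [IsNoetherianRing U]
    (σ : V →ₐ[U] V) {d : ℕ} (hd : 0 < d) (hσd : σ ^ d = 1)
    (hfix : ∀ v : V, σ v = v → ∃ u : U, algebraMap U V u = v) (hinj : Function.Injective (algebraMap U V))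
    (ω : U) (hωd : ω ^ d = 1) (horth : ∀ m : ℕ, ¬ d ∣ m → ∑ i ∈ Finset.range d, ω ^ (m * i) = 0)
    (hdU : IsUnit ((d : ℕ) : U))
    (hbig : ∀ j, j < d → ∀ P : Ideal V, P.IsPrime → P.height = 1 →
      ∃ m : V, σ m = algebraMap U V ω ^ j * m ∧ m ∉ P)
    {c : V} (hc3 : c ∈ cohomologyAnnihilatorOfDegree V 3) (gc : ℕ) (hc : σ c = algebraMap U V ω ^ gc * c)
    {a : V}
    (ha : ∀ j' : Fin d, ∃ (m : ℕ) (b b' : Fin m → V) (l : ℕ), (∀ k, σ (b k) = algebraMap U V ω ^ (j' : ℕ) * b k) ∧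
      (∀ k, σ (b' k) = algebraMap U V ω ^ l * b' k) ∧ d ∣ (j' : ℕ) + l + gc ∧ ∑ k, b k * b' k = a)
    (u : U) (hu : algebraMap U V u = a * c) : u ∈ cohomologyAnnihilatorOfDegree U 3 := by
  obtain ⟨hfin, hproj⟩ := finite_projective_coind_of_isIntegrallyClosed σ hd hσd hfix hinj ω hωd horth hdU hbig
  exact mul_mem_cohomologyAnnihilatorOfDegree_three σ hd hσd hfix hinj ω hωd horth hdU hc3 gc hc ha u hu

/-- **T-V, pure-power form, standard hypotheses**: `σ w = ω w`, `w ∈ ca³(V)` ⟹ `w ^ d ∈ ca³(U)` (`V` noetherian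
normal domain with (BIG)). [folklore] -/
theorem pow_mem_cohomologyAnnihilatorOfDegree_three_of_isIntegrallyClosed [IsNoetherianRing U]
    (σ : V →ₐ[U] V) {d : ℕ} (hd : 0 < d) (hσd : σ ^ d = 1)
    (hfix : ∀ v : V, σ v = v → ∃ u : U, algebraMap U V u = v) (hinj : Function.Injective (algebraMap U V))
    (ω : U) (hωd : ω ^ d = 1) (horth : ∀ m : ℕ, ¬ d ∣ m → ∑ i ∈ Finset.range d, ω ^ (m * i) = 0)
    (hdU : IsUnit ((d : ℕ) : U))
    (hbig : ∀ j, j < d → ∀ P : Ideal V, P.IsPrime → P.height = 1 →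
      ∃ m : V, σ m = algebraMap U V ω ^ j * m ∧ m ∉ P)
    {w : V} (hw3 : w ∈ cohomologyAnnihilatorOfDegree V 3) (hw : σ w = algebraMap U V ω * w) (u : U)
    (hu : algebraMap U V u = w ^ d) : u ∈ cohomologyAnnihilatorOfDegree U 3 := by
  obtain ⟨hfin, hproj⟩ := finite_projective_coind_of_isIntegrallyClosed σ hd hσd hfix hinj ω hωd horth hdU hbig
  exact pow_mem_cohomologyAnnihilatorOfDegree_three σ hd hσd hfix hinj ω hωd horth hdU hw3 hw u hu

end Normal

end Summit.ResolutionOfSingularities.ResolutionOfSingularities.Theorems.HomologicalConductor.PersistenceCyclicTransferPairing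

end
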